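import Literature.NumberTheory.EllipticCurves.PadicTwoSupportOfColemanTrace
import Literature.NumberTheory.EllipticCurves.ProfiniteGroupDistributionCharacterCells
import HarnessLib

/-!
# `p = 2`: de Shalit's (10)+(11) joined — the pull-back `D_β = comap μ_β♭ ψ` of the measure of a trace-zero
# Coleman series along `κ` has moments `∫_{U_0} κ(σ)^{k+1} dD_β(σ) = [S^0] D^k (θ(h_β ∘ ϑ))`

Topic `NumberTheory/EllipticCurves`; namespace `Literature.NumberTheory.EllipticCurves`.

De Shalit, *Iwasawa theory of elliptic curves with complex multiplication* (1987), I.3.3–3.5: the measure `μ_β`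
of a norm-coherent unit is read on `ℤ_p` through `θ` ((8)), lives on `ℤ_p^×` ((7) ⟺ (7′)), is pulled back
to `G = Gal(k_ξ/k')` along `κ : G ≃ ℤ_p^×` ((9)–(10)), and has moments `∫_G κ^k dμ_β = D^k log g_β(0)` ((11)).
This file composes, at `p = 2`, the plug `𝒮_{f'} h₀ = 0 ⟹ support on ℤ₂^× + socket`
(`PAdicOneVariableSupportOfColemanTraceTwo.lean`, `PadicTwoSupportOfColemanTrace.lean`) with the abstract
pull-back along a character `κ : G →* ℤ_2^×` of `ProfiniteGroupDistributionCharacterCells.lean`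
(`GroupDistribution.integral_comap_restrictUnits_of_character_two`, de Shalit's (10)) — for ANY tower `𝒰` and
character satisfying the cell hypotheses `hU`/`hκ` (their arithmetic instance, de Shalit II.1.7–1.9, is the
class-field-theory lane's GAP-6b):

* ★★★ `integral_comap_character_pow_succ_of_colemanTrace_eq_zero` — along any continuous ring map
  `θ : ℂ_F → ℂ_[2]` of norm `≤ 1` on `𝒪_{ℂ_F}` reaching the `2`-power roots of unity:
  **`∫_G 𝟙_{U_0}(σ) κ(σ)^{k+1} d(comap μ♭ ψ)(σ) = [S^0] D^k H'`**, `H' = θ(h₀ ∘ ϑ)`,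
  `μ♭ = restrictUnits (x⁻¹ · D_{H'})`, for every `k` (de Shalit's (10)+(11) for the log-free measure);
* ★★★ `PadicTwo.integral_comap_character_pow_succ_of_colemanTrace_eq_zero` — the same over `F = ℚ_[2]` with
  `θ := CompletedAlgClosure.equivPadicComplex 2`.

Everything is proved; no named facts, no definitions, no instances, no `sorry`.

## References

* [deShalit1987] E. de Shalit, *Iwasawa theory of elliptic curves with complex multiplication* (1987),
  I.3.3 (7)–(9) (p. 17–18), I.3.4 (10), I.3.5 (11) (p. 18), II.4.6–4.7 (16)–(17) (p. 59–60).
-/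

noncomputable section

open MvPowerSeries Filter
open scoped PowerSeries.WithPiTopology Topology Classical

namespace Literature.NumberTheory.EllipticCurves

section GaloisMomentsOfColemanTraceTwo

open ValuativeRel IsLocalRing Field
open Literature.NumberTheory.GaloisRepresentations Literature.NumberTheory.GaloisRepresentations.IsNonarchimedeanLocalField
  Literature.NumberTheory.GaloisRepresentations.LubinTate Literature.NumberTheory.PAdicHodge

variable {F : Type} [Field F] [ValuativeRel F] [TopologicalSpace F] [IsNonarchimedeanLocalField F]

attribute [local instance] ltNormUniformSpace ltNormIsUniformAddGroup rk1 nF nE fintypeResidueField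

variable (hq : residueFieldCard F = 2) (h2 : (valuation F).IsUniformizer (((2 : ℕ) : 𝒪[F]) : F))
  {σ₀ : absoluteGaloisGroup F} (hσ₀ : IsAbsArithFrob σ₀) (u : 𝒪[F]ˣ)
  {ε : (maxUnramifiedCompletion F)ˣ}
  (hε : maxUnramifiedCompletion.galAut F σ₀ (ε : maxUnramifiedCompletion F) =
    algebraMap 𝒪[F] (maxUnramifiedCompletion F) (u : 𝒪[F]) * (ε : maxUnramifiedCompletion F))
variable (θ : CompletedAlgClosure F →+* ℂ_[2]) (hθc : Continuous θ)
  (hθ1 : ∀ z : CBall F, ‖θ (z : CompletedAlgClosure F)‖ ≤ 1)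
  (hθζ : ∀ ζ' : ℂ_[2], (∃ n : ℕ, ζ' ^ 2 ^ n = 1) →
    ∃ ζ : CompletedAlgClosure F, (∃ n : ℕ, ζ ^ 2 ^ n = 1) ∧ θ ζ = ζ')
variable {G : Type*} [Group G] {𝒰 : SubgroupTower G} [∀ n, (𝒰.U n).Normal] (κ : G →* ℤ_[2]ˣ)
  (hU : ∀ (n : ℕ) (σ : G), σ ∈ 𝒰.U n ↔ σ ∈ 𝒰.U 0 ∧ PadicInt.toZModPow (n + 1) (κ σ : ℤ_[2]) = 1)
  (hκ : ∀ (n : ℕ) (w : ℤ_[2]ˣ), PadicInt.toZModPow 1 (w : ℤ_[2]) = 1 →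
    ∃ σ ∈ 𝒰.U 0, PadicInt.toZModPow (n + 1) (κ σ : ℤ_[2]) = PadicInt.toZModPow (n + 1) (w : ℤ_[2]))
  (ψ : (n : ℕ) → G ⧸ 𝒰.U n → ZMod (2 ^ (n + 1)))
  (hψ : ∀ (n : ℕ) (σ : G), σ ∈ 𝒰.U 0 → ψ n (𝒰.proj n σ) = PadicInt.toZModPow (n + 1) (κ σ : ℤ_[2]))

include hq hθc hθζ in
/-- ★★★ **De Shalit's (10)+(11) at `p = 2` for the log-free measure of a trace-zero Coleman series**: with
`H' := θ(h₀ ∘ ϑ)`, `μ♭ := restrictUnits (x⁻¹ · D_{H'})` and `D := comap μ♭ ψ` (the pull-back to `U_0 ⊆ G`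
along `κ mod 2^{n+1}`), **`∫_G 𝟙_{U_0}(σ) κ(σ)^{k+1} dD(σ) = [S^0] D^k H'`** for every `k`.
[cite: deShalit1987, I.3.4 (10), I.3.5 (11) (p. 18)] -/
theorem integral_comap_character_pow_succ_of_colemanTrace_eq_zero (n : ℕ) (h₀ : PowerSeries (LTCoeff F))
    (hS : colemanTrace (isUniformizer_unit_mul h2 u) n h₀ = 0) (k : ℕ) :
    (GroupDistribution.comap (restrictUnits ((invAmice₁ 2
        ((PowerSeries.subst ((compSeriesC h2 hσ₀ u hε).map (algebraMap (UnrCoeff F) (CBall F)))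
          (h₀.map ((algebraMap (UnrCoeff F) (CBall F)).comp
            ((intToUnrCoeff F).comp (LTCoeff.of F).symm.toRingHom)))).map (θ.comp (CBall F).subtype))
        (norm_coeff_map_le_one θ hθ1
          (PowerSeries.subst ((compSeriesC h2 hσ₀ u hε).map (algebraMap (UnrCoeff F) (CBall F)))
            (h₀.map ((algebraMap (UnrCoeff F) (CBall F)).comp
              ((intToUnrCoeff F).comp (LTCoeff.of F).symm.toRingHom)))))).density
        (ProfiniteTower.padicInt_isUniform 2) (unitInv ℂ_[2]) uniformContinuous_unitInv norm_unitInv_le))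
        ψ (𝒰.cellMap_trans κ ψ hψ) (𝒰.cellMap_injective κ hU ψ hψ) (𝒰.cellMap_fiberSurj κ hU hκ ψ hψ)).integral
        (fun σ ↦ (if 𝒰.proj 0 σ = 1 then (1 : ℂ_[2]) else 0) * padicIntCast ℂ_[2] ((κ σ : ℤ_[2]) ^ (k + 1))) =
      PowerSeries.constantCoeff (mahlerD^[k]
        ((PowerSeries.subst ((compSeriesC h2 hσ₀ u hε).map (algebraMap (UnrCoeff F) (CBall F)))
          (h₀.map ((algebraMap (UnrCoeff F) (CBall F)).comp
            ((intToUnrCoeff F).comp (LTCoeff.of F).symm.toRingHom)))).map (θ.comp (CBall F).subtype))) := by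
  have h := GroupDistribution.integral_comap_restrictUnits_of_character_two κ
    ((invAmice₁ 2
        ((PowerSeries.subst ((compSeriesC h2 hσ₀ u hε).map (algebraMap (UnrCoeff F) (CBall F)))
          (h₀.map ((algebraMap (UnrCoeff F) (CBall F)).comp
            ((intToUnrCoeff F).comp (LTCoeff.of F).symm.toRingHom)))).map (θ.comp (CBall F).subtype))
        (norm_coeff_map_le_one θ hθ1 _)).density
        (ProfiniteTower.padicInt_isUniform 2) (unitInv ℂ_[2]) uniformContinuous_unitInv norm_unitInv_le)
    hU hκ ψ hψ (uniformContinuous_padicIntCast_pow (𝕜 := ℂ_[2]) (k + 1))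
  exact h.trans (integral_restrictUnits_density_unitInv_pow_succ_of_colemanTrace_eq_zero hq h2 hσ₀ u hε θ hθc
    hθ1 hθζ n h₀ hS k)

end GaloisMomentsOfColemanTraceTwo

namespace PadicTwo

open ValuativeRel IsLocalRing Field
open Literature.NumberTheory.GaloisRepresentations Literature.NumberTheory.GaloisRepresentations.IsNonarchimedeanLocalField
  Literature.NumberTheory.GaloisRepresentations.LubinTate Literature.NumberTheory.PAdicHodge

attribute [local instance] ltNormUniformSpace ltNormIsUniformAddGroup rk1 nF nE fintypeResidueField

variable {G : Type*} [Group G] {𝒰 : SubgroupTower G} [∀ n, (𝒰.U n).Normal] (κ : G →* ℤ_[2]ˣ)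
  (hU : ∀ (n : ℕ) (σ : G), σ ∈ 𝒰.U n ↔ σ ∈ 𝒰.U 0 ∧ PadicInt.toZModPow (n + 1) (κ σ : ℤ_[2]) = 1)
  (hκ : ∀ (n : ℕ) (w : ℤ_[2]ˣ), PadicInt.toZModPow 1 (w : ℤ_[2]) = 1 →
    ∃ σ ∈ 𝒰.U 0, PadicInt.toZModPow (n + 1) (κ σ : ℤ_[2]) = PadicInt.toZModPow (n + 1) (w : ℤ_[2]))
  (ψ : (n : ℕ) → G ⧸ 𝒰.U n → ZMod (2 ^ (n + 1)))
  (hψ : ∀ (n : ℕ) (σ : G), σ ∈ 𝒰.U 0 → ψ n (𝒰.proj n σ) = PadicInt.toZModPow (n + 1) (κ σ : ℤ_[2]))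

/-- ★★★ **`F = ℚ₂`, `θ = equivPadicComplex 2`: `∫_G 𝟙_{U_0}(σ) κ(σ)^{k+1} d(comap μ♭ ψ)(σ) = [S^0] D^k (θ(h₀∘ϑ))`**
for every trace-zero `h₀ ∈ ℤ₂⟦X⟧` and every `k` (de Shalit's (10)+(11) at the split prime `2`).
[cite: deShalit1987, I.3.4 (10), I.3.5 (11) (p. 18)] -/
theorem integral_comap_character_pow_succ_of_colemanTrace_eq_zero :
    haveI := Padic.isNonarchimedeanLocalField_holds 2
    ∀ {σ₀ : absoluteGaloisGroup ℚ_[2]} (hσ₀ : IsAbsArithFrob σ₀) (u : 𝒪[ℚ_[2]]ˣ)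
      {ε : (maxUnramifiedCompletion ℚ_[2])ˣ}
      (hε : maxUnramifiedCompletion.galAut ℚ_[2] σ₀ (ε : maxUnramifiedCompletion ℚ_[2]) =
        algebraMap 𝒪[ℚ_[2]] (maxUnramifiedCompletion ℚ_[2]) (u : 𝒪[ℚ_[2]]) * (ε : maxUnramifiedCompletion ℚ_[2]))
      (n : ℕ) (h₀ : PowerSeries (LTCoeff ℚ_[2]))
      (_hS : colemanTrace (isUniformizer_unit_mul (Padic.isUniformizer_natCast 2) u) n h₀ = 0) (k : ℕ),
      (GroupDistribution.comap (restrictUnits ((invAmice₁ 2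
        ((PowerSeries.subst ((compSeriesC (Padic.isUniformizer_natCast 2) hσ₀ u hε).map
            (algebraMap (UnrCoeff ℚ_[2]) (CBall ℚ_[2])))
          (h₀.map ((algebraMap (UnrCoeff ℚ_[2]) (CBall ℚ_[2])).comp
            ((intToUnrCoeff ℚ_[2]).comp (LTCoeff.of ℚ_[2]).symm.toRingHom)))).map
          ((CompletedAlgClosure.equivPadicComplex 2).toRingHom.comp (CBall ℚ_[2]).subtype))
        (norm_coeff_map_le_one _ norm_equivPadicComplex_coe_cBall_le_one _)).density
        (ProfiniteTower.padicInt_isUniform 2) (unitInv ℂ_[2]) uniformContinuous_unitInv norm_unitInv_le))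
        ψ (𝒰.cellMap_trans κ ψ hψ) (𝒰.cellMap_injective κ hU ψ hψ) (𝒰.cellMap_fiberSurj κ hU hκ ψ hψ)).integral
        (fun σ ↦ (if 𝒰.proj 0 σ = 1 then (1 : ℂ_[2]) else 0) * padicIntCast ℂ_[2] ((κ σ : ℤ_[2]) ^ (k + 1))) =
      PowerSeries.constantCoeff (mahlerD^[k]
        ((PowerSeries.subst ((compSeriesC (Padic.isUniformizer_natCast 2) hσ₀ u hε).map
            (algebraMap (UnrCoeff ℚ_[2]) (CBall ℚ_[2])))
          (h₀.map ((algebraMap (UnrCoeff ℚ_[2]) (CBall ℚ_[2])).comp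
            ((intToUnrCoeff ℚ_[2]).comp (LTCoeff.of ℚ_[2]).symm.toRingHom)))).map
          ((CompletedAlgClosure.equivPadicComplex 2).toRingHom.comp (CBall ℚ_[2]).subtype))) := by
  haveI := Padic.isNonarchimedeanLocalField_holds 2
  intro σ₀ hσ₀ u ε hε n h₀ hS k
  exact Literature.NumberTheory.EllipticCurves.integral_comap_character_pow_succ_of_colemanTrace_eq_zero
    (Padic.residueFieldCard_eq 2) (Padic.isUniformizer_natCast 2) hσ₀ u hε _
    continuous_equivPadicComplex_toRingHom norm_equivPadicComplex_coe_cBall_le_one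
    exists_pow_two_pow_eq_one_equivPadicComplex_eq κ hU hκ ψ hψ n h₀ hS k

end PadicTwo

end Literature.NumberTheory.EllipticCurves

end
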